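import Literature.NumberTheory.EllipticCurves.AnticyclotomicSignedSelmer
import Literature.NumberTheory.EllipticCurves.BigRepModuleShapiroSelmerConditionsProofs
import Literature.NumberTheory.EllipticCurves.SubgroupSelmerCocycleCriteriaProofs
import HarnessLib

/-!
# The order `str ≤ ± ≤ rel` of Castella–Wan's local conditions above `p` over `K_∞`, and the
# resulting inclusions among the nine groups `Sel^{𝓛,Σ}(K_∞, E[p^∞])` (proved)

`Proofs`-style sequel of `Literature/NumberTheory/EllipticCurves/AnticyclotomicSignedSelmer.lean`
(utd-ty1 g0, p600108), whose docstring of `selmer_le_of_rel` refers to a lemma `condAbove_str_le`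
that the file does not contain. THEOREMS ONLY (no definition, no named fact, no `sorry`), for EVERY
elliptic curve over a number field, every prime `p`, every `ℤ_p`-extension `κ`, every place `v`:

* §1 `awayKer_le_localKummerOverOfEmb` — a class of `H¹(H, E[p^∞])` that DIES on `H ⊓ D_v` (the
  decomposition group of the place above `v` singled out by the chosen embedding `closureEmb K_v`;
  Greenberg's `awayKer`, = Castella's strict condition `M⁺_v = 0` by
  `strictKer_strictDatum_eq_awayKer`) satisfies Kobayashi's Kummer condition cut out by ANY subgroup
  `A` of local points: if `φ(δ) = δm − m` on `H ⊓ D_v` for a torsion point `m ∈ E[p^∞]`, then along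
  the embedding `φ` is the Kummer cocycle of `Q = ι(m)` with `p^k Q = O ∈ A`. Hence
  **`condAbove_str_le`**: `condAbove v str ≤ condAbove v 𝓛` for every `𝓛 ∈ {rel, ±, str}` (with
  `condAbove_le_rel`: the three conditions above `p` are totally ordered `str ≤ ± ≤ rel`).
* §2 **`selmer_mono_cond`** — if at every `v ∣ p` either `𝓛 v = 𝓛' v`, or `𝓛' v = rel`, or `𝓛 v = str`,
  then `Sel^{𝓛,Σ} ≤ Sel^{𝓛',Σ}`; in particular (`PCond.at`-form, `𝔭′ ≠ 𝔭`)
  `Sel^{str,ε} ≤ Sel^{ε,ε}` (the kernel in Castella–Wan's tautological exact sequence (5.10)/(6.12)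
  `0 → Sel^{str,±} → Sel^{±,±} → H¹_±(K_𝔭)`), `Sel^{ε,str} ≤ Sel^{ε,ε}`, `Sel^{rel,str} ≤ Sel^{rel,ε}`,
  `Sel^{ε,ε} ≤ Sel^{ε,rel}` (Lemma 5.9: "`Sel^{ε,ε}(K,𝐓^ac) = Sel^{ε,rel}(K,𝐓^ac)`" starts from this
  inclusion), as named corollaries.

Discrete (`𝐀^ac`) side only; the dual statements (surjections `X^{𝓛',Σ} ↠ X^{𝓛,Σ}`) are not in this
file. Banking for the `⊇`-port of the BSD summit's crux `TwinSplitIMCAtThreeGoodSSApZero`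
(stmt-BirchSwinnertonDyer-23594; width seat bsd-wall-utd-p2-w2). BSD is not advanced by this file.

References: [CastellaWan2023] F. Castella, X. Wan, Math. Ann. 389 (2024), §4.2, Def. 5.1, Lemma 5.9,
(5.10), (6.12)–(6.13); [Greenberg1989] R. Greenberg, Adv. Stud. Pure Math. 17 (1989), §1 p. 98 (strict
conditions); [Kobayashi2003] S. Kobayashi, Invent. Math. 152 (2003), Def. 1.1 and §2 p. 4 (the Kummer
map); [BDKim2013] B. D. Kim, J. Aust. Math. Soc. 95 (2013), Def. 3.1/3.3/3.5.
-/

open CategoryTheory Literature.NumberTheory.EllipticCurves Literature.NumberTheory.GaloisRepresentations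

universe u

noncomputable section

namespace Literature.NumberTheory.EllipticCurves.AcSigned

open scoped Classical AddSubgroup
open NumberField IsDedekindDomain Field
open _root_.WeierstrassCurve
open Literature.NumberTheory.EllipticCurves.GreenbergSelmer
open Literature.NumberTheory.EllipticCurves.Kobayashi2003
open Literature.NumberTheory.EllipticCurves.CocycleCriteria
open Literature.NumberTheory.EllipticCurves.BigGaloisRep

/-! ## §1 Dying on `H ⊓ D_v` implies every Kummer condition at the chosen place above `v` -/

section Local

variable {K : Type u} [Field K] [NumberField K] (W : WeierstrassCurve K) (p : ℕ) [Fact p.Prime]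
  (H : Subgroup (absoluteGaloisGroup K)) (v : HeightOneSpectrum (𝓞 K))

omit [Fact p.Prime] in
/-- **A class dying on `H ⊓ D_v` satisfies EVERY Kummer condition at the chosen place above `v`.**
For `H ≤ Γ_K` (fixed field `L`), a finite place `v` and ANY subgroup `A ⊆ E(K̄_v)`: Greenberg's
`awayKer H E[p^∞] v` (classes restricting to `0` in `H¹(H ⊓ D_v, E[p^∞])`, `D_v` the decomposition
group of the chosen embedding `closureEmb K_v`) is contained in Kobayashi's
`localKummerOverOfEmb … (closureEmb K_v) A` (classes `[φ]` with `ι φ(τ) = τQ − Q` on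
`Gal(K̄_v/L_w)` for some `Q` with `p^k Q ∈ A`): if `φ(δ) = δ m − m` on `H ⊓ D_v` for a torsion point
`m ∈ E[p^∞]`, `p^k m = O`, take `Q = ι(m)`, so `p^k Q = O ∈ A` (`resH1Hom_oneCocycleClass_eq_zero_iff`,
`pointsMapOfEmb_smul`). (Kobayashi p. 4: "We regard `E(K_{n,v}) ⊗ ℚ_p/ℤ_p` as a subgroup of
`H¹(K_{n,v}, E[p^∞])` by the Kummer map" — the zero class is the Kummer class of `O`.)
[cite: Kobayashi2003, Def. 1.1 and §2 p. 4] [cite: Greenberg1989, §1 p. 98 (the strict condition)] -/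
theorem awayKer_le_localKummerOverOfEmb
    (A : AddSubgroup (localPoints W (v.adicCompletion K))) :
    awayKer H (W.geomPrimaryTorsion p) v ≤
      localKummerOverOfEmb W p H (closureEmb (K := K) (v.adicCompletion K)) A := by
  intro c hc
  set ι := closureEmb (K := K) (v.adicCompletion K) with hι
  obtain ⟨φ, rfl⟩ := oneCocycleClass_surjective (discreteTopRep H (W.geomPrimaryTorsion p)) c
  have h0 : resOfLe (W.geomPrimaryTorsion p) (inf_le_left : H ⊓ decomp v ≤ H)
      (oneCocycleClass (discreteTopRep H (W.geomPrimaryTorsion p)) φ) = 0 := hc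
  rw [resOfLe, resH1Hom_oneCocycleClass_eq_zero_iff] at h0
  obtain ⟨m, hm⟩ := h0
  obtain ⟨k, hk⟩ := AddCommGroup.mem_primaryComponent.mp m.2
  refine ⟨φ, pointsMapOfEmb W ι (m : W.geomPoints), k, rfl, ?_, fun τ ↦ ?_⟩
  · rw [← map_nsmul, hk, map_zero]
    exact A.zero_mem
  · have hmem : resGalOfEmb ι τ ∈ H ⊓ decomp v :=
      Subgroup.mem_inf.mpr ⟨τ.2, (mem_decomp_iff v _).mpr ⟨τ, rfl⟩⟩
    have h1 := hm ⟨resGalOfEmb ι τ, hmem⟩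
    have h2 : φ.1 (resGalSubgroupOfEmb H ι τ) = (resGalOfEmb ι τ) • m - m := by
      have h3 : subgroupInclusion (inf_le_left : H ⊓ decomp v ≤ H) ⟨resGalOfEmb ι τ, hmem⟩ =
          resGalSubgroupOfEmb H ι τ := Subtype.ext rfl
      rw [← h3]
      exact h1
    rw [h2, AddSubgroupClass.coe_sub, map_sub, primaryComponent.coe_smul, pointsMapOfEmb_smul]

end Local

/-! ## §1 (cont.) `str ≤ 𝓛 ≤ rel` for the conditions above `p` over `K_∞` -/

section Order

variable {K : Type u} [Field K] [NumberField K] (W : WeierstrassCurve K) (p : ℕ) [Fact p.Prime]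
  (κ : ZpExtension K p)

/-- **`condAbove v str ≤ condAbove v 𝓛`** for every condition type `𝓛`: the strict condition (every
conjugate dies at the chosen place above `v`, Castella's datum `M⁺_v = 0`, =
`awayKer` by `strictKer_strictDatum_eq_awayKer`) implies the signed Kummer condition `ℋ^ε_w`
(`awayKer_le_localKummerOverOfEmb` with `A = E^ε(K_∞·K_v)`) and, trivially, the relaxed one. This is
the lemma the carrier file's docstring of `selmer_le_of_rel` refers to.
[cite: CastellaWan2023, Def. 5.1 (MS p. 23), "`𝓛_v ∈ {∅, Gr, 0}`" / `{rel, ±, str}`] [cite: BDKim2013, Def. 3.3 and Def. 3.5 (pp. 193–194)] -/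
theorem condAbove_str_le (v : HeightOneSpectrum (𝓞 K)) (L : PCond) :
    condAbove W p κ v .str ≤ condAbove W p κ v L := by
  intro c hc
  cases L with
  | rel => exact AddSubgroup.mem_top c
  | str => exact hc
  | sgn ε =>
    rw [mem_condAbove_str_iff] at hc
    rw [mem_condAbove_sgn_iff]
    intro σ
    have h := hc σ
    rw [strictKer_strictDatum_eq_awayKer] at h
    exact awayKer_le_localKummerOverOfEmb W p κ.kerSubgroup v _ h

/-- **`condAbove v 𝓛 ≤ condAbove v rel`** (no condition). [cite: CastellaWan2023, Def. 5.1 (MS p. 23)] -/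
theorem condAbove_le_rel (v : HeightOneSpectrum (𝓞 K)) (L : PCond) :
    condAbove W p κ v L ≤ condAbove W p κ v .rel :=
  fun c _ ↦ AddSubgroup.mem_top c

/-! ## §2 Inclusions among the nine groups `Sel^{𝓛,Σ}(K_∞, E[p^∞])` -/

/-- **Monotonicity of `Sel^{𝓛,Σ}` in the conditions above `p`**: if at every `v ∣ p` either
`𝓛 v = 𝓛' v`, or `𝓛' v = rel`, or `𝓛 v = str` (i.e. `𝓛 v ≤ 𝓛' v` for the order `str ≤ ± ≤ rel`;
the two signs `+`/`−` are incomparable), then `Sel^{𝓛,Σ} ≤ Sel^{𝓛',Σ}` — extending the carrier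
file's `selmer_le_of_rel` by the strict case (`condAbove_str_le`).
[cite: CastellaWan2023, Def. 5.1, Lemma 5.9, (6.12)–(6.13) (MS pp. 23, 26, 30)] -/
theorem selmer_mono_cond {S : Set (HeightOneSpectrum (𝓞 K))} {L L' : HeightOneSpectrum (𝓞 K) → PCond}
    (h : ∀ v : HeightOneSpectrum (𝓞 K), ((p : ℕ) : 𝓞 K) ∈ v.asIdeal →
      L' v = L v ∨ L' v = .rel ∨ L v = .str) :
    selmer W p κ S L ≤ selmer W p κ S L' := by
  intro c hc
  rw [mem_selmer_iff] at hc ⊢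
  refine ⟨hc.1, fun v hv ↦ ?_⟩
  rcases h v hv with h' | h' | h'
  · rw [h']; exact hc.2 v hv
  · rw [h']; exact AddSubgroup.mem_top _
  · have hcv := hc.2 v hv
    rw [h'] at hcv
    exact condAbove_str_le W p κ v (L' v) hcv

variable {𝔮 : HeightOneSpectrum (𝓞 K)} (S : Set (HeightOneSpectrum (𝓞 K)))

/-- **`Sel^{str at 𝔮, b elsewhere} ≤ Sel^{a at 𝔮, b elsewhere}`** for every `a`: e.g. (`𝔮 = 𝔭`,
`a = b = ±`) `Sel^{str,±} ≤ Sel^{±,±}`, the kernel of `loc_𝔭` in Castella–Wan's tautological sequence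
(5.10)/(6.12) `0 → Sel^{str,±} → Sel^{±,±} → H¹_±(K_𝔭, ·)`; (`a = rel`) `Sel^{str,b} ≤ Sel^{rel,b}`.
[cite: CastellaWan2023, Lemma 5.10 / (6.12) (MS pp. 26, 30)] -/
theorem selmer_at_str_le (a b : PCond) :
    selmer W p κ S (PCond.at 𝔮 .str b) ≤ selmer W p κ S (PCond.at 𝔮 a b) := by
  refine selmer_mono_cond W p κ fun v _ ↦ ?_
  by_cases hv : v = 𝔮
  · subst hv
    exact Or.inr (Or.inr (by rw [PCond.at_self]))
  · exact Or.inl (by rw [PCond.at_of_ne a b hv, PCond.at_of_ne .str b hv])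

/-- **`Sel^{a at 𝔮, str elsewhere} ≤ Sel^{a at 𝔮, b elsewhere}`** for every `b`: e.g. (`𝔮 = 𝔭`,
`a = b = ±`) `Sel^{±,str} ≤ Sel^{±,±}` and (`a = rel`, `b = ±`) `Sel^{rel,str} ≤ Sel^{rel,±}` — the
inclusions behind Castella–Wan's (6.13)/(PT4) "`X^{rel,±} ↠ X^{rel,str}`"-type maps on the discrete
side. [cite: CastellaWan2023, Lemma 6.7 and (6.13) (MS pp. 28, 30)] -/
theorem selmer_at_str_away_le (a b : PCond) :
    selmer W p κ S (PCond.at 𝔮 a .str) ≤ selmer W p κ S (PCond.at 𝔮 a b) := by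
  refine selmer_mono_cond W p κ fun v _ ↦ ?_
  by_cases hv : v = 𝔮
  · subst hv
    exact Or.inl (by rw [PCond.at_self, PCond.at_self])
  · exact Or.inr (Or.inr (by rw [PCond.at_of_ne a .str hv]))

/-- **`Sel^{a at 𝔮, b elsewhere} ≤ Sel^{a at 𝔮, rel elsewhere}`**: e.g. `Sel^{±,±} ≤ Sel^{±,rel}`, the
inclusion from which Castella–Wan's Lemma 5.9 ("`Sel^{ε,ε}(K, 𝐓^ac) = Sel^{ε,rel}(K, 𝐓^ac)` when the
`Λ^ac`-rank is one") starts (a case of the carrier file's `selmer_le_of_rel`, recorded by name).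
[cite: CastellaWan2023, Lemma 5.9 (MS p. 26)] -/
theorem selmer_at_le_rel_away (a b : PCond) :
    selmer W p κ S (PCond.at 𝔮 a b) ≤ selmer W p κ S (PCond.at 𝔮 a .rel) := by
  refine selmer_mono_cond W p κ fun v _ ↦ ?_
  by_cases hv : v = 𝔮
  · subst hv
    exact Or.inl (by rw [PCond.at_self, PCond.at_self])
  · exact Or.inr (Or.inl (by rw [PCond.at_of_ne a .rel hv]))

/-- **`Sel^{a at 𝔮, b elsewhere} ≤ Sel^{rel at 𝔮, b elsewhere}`**: e.g. `Sel^{±,str} ≤ Sel^{rel,str}`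
(so `X^{rel,str} ↠ X^{±,str}` on the dual side, Castella–Wan (6.12)).
[cite: CastellaWan2023, (6.12) (MS p. 30)] -/
theorem selmer_at_le_rel_at (a b : PCond) :
    selmer W p κ S (PCond.at 𝔮 a b) ≤ selmer W p κ S (PCond.at 𝔮 .rel b) := by
  refine selmer_mono_cond W p κ fun v _ ↦ ?_
  by_cases hv : v = 𝔮
  · subst hv
    exact Or.inr (Or.inl (by rw [PCond.at_self]))
  · exact Or.inl (by rw [PCond.at_of_ne .rel b hv, PCond.at_of_ne a b hv])

end Order

end Literature.NumberTheory.EllipticCurves.AcSigned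

end
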